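import Literature.NumberTheory.GaloisRepresentations.ResidualRepRestrict
import Literature.NumberTheory.GaloisRepresentations.ResidualGaloisRepOpenKernel
import Literature.RepresentationTheory.Semisimple.IrreducibleOfCharpoly
import HarnessLib

/-!
# Residual representations along a residue embedding: extension of scalars `ρ̄ ↦ GL_n(f) ∘ ρ̄`

Topic `NumberTheory/GaloisRepresentations` (vocabulary of `ResidualGaloisRep.lean`:
`integralReduction`, `IsReductionOf`, `HasResidualCharpolys`, `IsSemisimplificationOf`,
`IsResidualRepOf`, `IsResiduallyAbsIrreducible` relative to a valuation subring `O ⊆ F` and a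
residue embedding `ι : O/𝔪 →+* k`; the framed Galois wrappers for `O = ℤ̄_ℓ ⊆ ℚ̄_ℓ` and the chosen
residual representation `FramedGaloisRep.residualRep : Γ_K → GL_n(ℤ̄_ℓ/𝔪)`).  Theorem-only file
(no definition, no named fact, D-0026).

The residual representation of `ρ : Γ_K → GL_n(ℚ̄_ℓ)` is used in the literature over "`𝔽̄_ℓ`",
i.e. over ANY algebraically closed (often: any) field `k` of characteristic `ℓ` receiving the
residue field, `ρ̄ ⊗_ι k = GL_n(ι) ∘ ρ̄` (ACC+ §1: "`ρ̄ : G_F → GL_n(𝔽̄_p)`"; Serre's conjecture is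
stated for `ρ̄ : G_ℚ → GL₂(𝔽̄_p)`; the tree's modularity facts at `p = 2`,
`Tung2020_fontaineMazurGL2_two_tateTwist` and `exists_newform_of_odd_irreducible`, quantify over
such models `k`, `ι : ℤ̄₂/𝔪 →+* k`, `τ = GL₂(ι) ∘ ρ.residualRep`).  This file supplies the
bookkeeping that pushes the tree's notions along a further ring map `f : k →+* k'`:

* `charpoly_generalLinearGroup_map`, `ker_generalLinearGroup_map_comp` — `det(X - GL_n(f)(g)) =
  f(det(X - g))`, `ker (GL_n(f) ∘ τ) = ker τ`;
* `integralReduction_comp_eq_map_comp`, `IsReductionOf.map`, `HasResidualCharpolys.map`,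
  `IsSemisimplificationOf.map`, `IsResidualRepOf.map`, `IsResidualRepOf.map_of_isIrreducible` —
  reductions, residual characteristic polynomials and (given semisimplicity of the target)
  semisimplifications / residual representations along `ι` push to ones along `f ∘ ι`;
* `IsResidualRepOf.isIrreducible_map_of_isResiduallyAbsIrreducible`,
  `IsResidualRepOf.map_of_isResiduallyAbsIrreducible` — **if `ρ` is residually absolutely
  irreducible, every residual representation `σ` of `ρ` over `O/𝔪` stays irreducible, and stays a
  residual representation, after ANY extension of scalars `f : O/𝔪 →+* k`**: `σ` and the absolutely
  irreducible reduction `τ` have the same characteristic polynomials (Brauer–Nesbitt data,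
  `IsResidualRepOf.charpoly_eq`), hence so do `GL_n(f) ∘ σ` and the irreducible `GL_n(f) ∘ τ`, and
  irreducibility is detected by characteristic polynomials
  (`Literature.RepresentationTheory.Semisimple.isIrreducible_of_charpoly_eq`);
* the `ℚ̄_ℓ` case: `FramedGaloisRep.isIrreducible_map_residualRep`,
  `FramedGaloisRep.isResidualRepOf_map_residualRep`, `FramedGaloisRep.isOpen_ker_map_residualRep`
  and the **discrete continuous model** `FramedGaloisRep.exists_framedGaloisRep_coe_eq_map_residualRep`:
  for `ρ` residually absolutely irreducible and `k` a discrete field receiving `ℤ̄_ℓ/𝔪` along `ι`,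
  `GL_n(ι) ∘ ρ.residualRep` underlies a continuous `τ : FramedGaloisRep K k n` (open kernel,
  Deligne–Serre 6.12, `isOpen_ker_of_isResidualRepOf`) which is irreducible and is a residual
  representation of `ρ` along `ι`;
* `FramedGaloisRep.isOdd_of_charP_two` — in characteristic `2` every framed Galois representation
  is odd (`det τ(c)² = 1` and `1 = -1`).

## References

* [DarmonDiamondTaylor1995] H. Darmon, F. Diamond, R. Taylor, *Fermat's Last Theorem* (1995),
  §2.1, p. 54 and Prop. 2.6 (b) (reductions, residual representations, Brauer–Nesbitt).
* [ACCGHLNSTT2023] P. B. Allen et al., *Potential automorphy over CM fields*, Ann. of Math. (2) 197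
  (2023), §1 (Notation: `ρ̄ : G_F → GL_n(𝔽̄_p)` the semisimplified reduction).
* [DeligneSerreASENS1974] P. Deligne, J.-P. Serre, *Formes modulaires de poids 1*, Ann. Sci. ÉNS
  (4) 7 (1974), 6.12.
* [BourbakiAlgebreVIII2012] N. Bourbaki, *Algèbre, Ch. VIII* (2012), § 20 n° 6, Thm. 2, Cor. 1.
-/

noncomputable section

open scoped MatrixGroups
open IsLocalRing Field

namespace Literature.NumberTheory.GaloisRepresentations

universe u v w w'

/-! ### `GL_n(f)`: characteristic polynomials and kernels -/

section GLMap

variable {R : Type w} {S : Type w'} [CommRing R] [CommRing S] {n : ℕ}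

/-- `det(X - GL_n(f)(g)) = f(det(X - g))` (Mathlib `Matrix.charpoly_map`). [folklore] -/
theorem charpoly_generalLinearGroup_map (f : R →+* S) (g : GL (Fin n) R) :
    ((Matrix.GeneralLinearGroup.map f g : GL (Fin n) S) : Matrix (Fin n) (Fin n) S).charpoly =
      ((g : GL (Fin n) R) : Matrix (Fin n) (Fin n) R).charpoly.map f := by
  rw [← Matrix.charpoly_map]
  rfl

variable {G : Type u} [Group G]

/-- For an injective `f`, `ker (GL_n(f) ∘ τ) = ker τ`. [folklore] -/
theorem ker_generalLinearGroup_map_comp {f : R →+* S} (hf : Function.Injective f)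
    (τ : G →* GL (Fin n) R) : ((Matrix.GeneralLinearGroup.map f).comp τ).ker = τ.ker := by
  ext g
  rw [MonoidHom.mem_ker, MonoidHom.mem_ker, MonoidHom.comp_apply]
  constructor
  · intro hg
    have hg' : ((Matrix.GeneralLinearGroup.map f (τ g) : GL (Fin n) S) : Matrix (Fin n) (Fin n) S) =
        ((Matrix.GeneralLinearGroup.map f (1 : GL (Fin n) R) : GL (Fin n) S) :
          Matrix (Fin n) (Fin n) S) := by
      rw [hg, map_one]
    exact Units.ext (Matrix.map_injective hf hg')
  · intro hg
    rw [hg, map_one]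

end GLMap

/-! ### Pushing reductions and residual representations along `f : k →+* k'` -/

section Reduction

variable {F : Type v} [Field F] {O : ValuationSubring F} {n : ℕ}
variable {G : Type u} [Group G] {k : Type w} [Field k] {k' : Type w'} [Field k']

/-- Reduction along `f ∘ ι` is `GL_n(f) ∘` (reduction along `ι`). [folklore] -/
theorem integralReduction_comp_eq_map_comp (ι : ResidueField O →+* k) (f : k →+* k')
    (ρ₀ : G →* GL (Fin n) O) :
    integralReduction (f.comp ι) ρ₀ = (Matrix.GeneralLinearGroup.map f).comp (integralReduction ι ρ₀) :=
  rfl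

/-- **A reduction of `ρ` along `ι`, pushed along `f : k →+* k'`, is a reduction of `ρ` along
`f ∘ ι`** (same integral model, conjugating matrix `GL_n(f)(Q)`).
[cite: DarmonDiamondTaylor1995, §2.1, p. 54] -/
theorem IsReductionOf.map {ι : ResidueField O →+* k} {ρ : G →* GL (Fin n) F}
    {τ : G →* GL (Fin n) k} (h : IsReductionOf ι ρ τ) (f : k →+* k') :
    IsReductionOf (f.comp ι) ρ ((Matrix.GeneralLinearGroup.map f).comp τ) := by
  obtain ⟨ρ₀, Q, hmodel, hQ⟩ := h
  refine ⟨ρ₀, Matrix.GeneralLinearGroup.map f Q, hmodel, fun g => ?_⟩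
  rw [MonoidHom.comp_apply, hQ g, map_mul, map_mul, map_inv, integralReduction_comp_eq_map_comp,
    MonoidHom.comp_apply]

/-- Residual characteristic polynomials along `ι` push to residual characteristic polynomials
along `f ∘ ι` (`det(X - GL_n(f) τ(g)) = f(det(X - τ(g)))`). [folklore] -/
theorem HasResidualCharpolys.map {ι : ResidueField O →+* k} {ρ : G →* GL (Fin n) F}
    {τ : G →* GL (Fin n) k} (h : HasResidualCharpolys ι ρ τ) (f : k →+* k') :
    HasResidualCharpolys (f.comp ι) ρ ((Matrix.GeneralLinearGroup.map f).comp τ) := by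
  intro g
  obtain ⟨P, hP, hPτ⟩ := h g
  refine ⟨P, hP, ?_⟩
  rw [RingHom.comp_assoc, ← Polynomial.map_map, hPτ, MonoidHom.comp_apply,
    charpoly_generalLinearGroup_map]

/-- **Semisimplifications push along `f`, given semisimplicity**: if `σ` is a semisimplification
of `τ` and `GL_n(f) ∘ σ` is semisimple, then `GL_n(f) ∘ σ` is a semisimplification of
`GL_n(f) ∘ τ` (characteristic polynomials map, kernels are unchanged).
[cite: DarmonDiamondTaylor1995, §2.1, p. 54] -/
theorem IsSemisimplificationOf.map {σ τ : G →* GL (Fin n) k} (h : IsSemisimplificationOf σ τ)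
    (f : k →+* k')
    (hss : (glRepresentation ((Matrix.GeneralLinearGroup.map f).comp σ)).IsSemisimpleRepresentation) :
    IsSemisimplificationOf ((Matrix.GeneralLinearGroup.map f).comp σ)
      ((Matrix.GeneralLinearGroup.map f).comp τ) := by
  refine ⟨hss, fun g => ?_, ?_⟩
  · rw [MonoidHom.comp_apply, MonoidHom.comp_apply, charpoly_generalLinearGroup_map,
      charpoly_generalLinearGroup_map, h.2.1 g]
  · rw [ker_generalLinearGroup_map_comp f.injective, ker_generalLinearGroup_map_comp f.injective]
    exact h.2.2

/-- **A residual representation of `ρ` along `ι`, pushed along `f`, is a residual representation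
of `ρ` along `f ∘ ι` whenever `GL_n(f) ∘ ρ̄` is semisimple** (`IsReductionOf.map`,
`IsSemisimplificationOf.map`).  (Semisimplicity after extension of scalars is automatic over a
perfect residue field, but is not proved here in general; see
`IsResidualRepOf.map_of_isResiduallyAbsIrreducible` for the residually absolutely irreducible
case.) [cite: ACCGHLNSTT2023, §1 (Notation)] [cite: DarmonDiamondTaylor1995, §2.1, p. 54] -/
theorem IsResidualRepOf.map {ι : ResidueField O →+* k} {ρ : G →* GL (Fin n) F}
    {τ : G →* GL (Fin n) k} (h : IsResidualRepOf ι ρ τ) (f : k →+* k')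
    (hss : (glRepresentation ((Matrix.GeneralLinearGroup.map f).comp τ)).IsSemisimpleRepresentation) :
    IsResidualRepOf (f.comp ι) ρ ((Matrix.GeneralLinearGroup.map f).comp τ) := by
  obtain ⟨τ₀, hred, hsemi⟩ := h
  exact ⟨_, hred.map f, hsemi.map f hss⟩

/-- **A residual representation whose extension of scalars is irreducible pushes to a residual
representation.** [cite: DarmonDiamondTaylor1995, §2.1, p. 54] -/
theorem IsResidualRepOf.map_of_isIrreducible {ι : ResidueField O →+* k} {ρ : G →* GL (Fin n) F}
    {τ : G →* GL (Fin n) k} (h : IsResidualRepOf ι ρ τ) (f : k →+* k')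
    (hirr : (glRepresentation ((Matrix.GeneralLinearGroup.map f).comp τ)).IsIrreducible) :
    IsResidualRepOf (f.comp ι) ρ ((Matrix.GeneralLinearGroup.map f).comp τ) :=
  h.map f (isSemisimpleRepresentation_of_isIrreducible hirr)

end Reduction

/-! ### Residually absolutely irreducible `ρ`: irreducibility survives every extension of scalars -/

section AbsIrreducible

variable {F : Type v} [Field F] {O : ValuationSubring F} {n : ℕ}
variable {G : Type u} [Group G] {k : Type v} [Field k]

/-- **For residually absolutely irreducible `ρ`, every residual representation `σ` of `ρ` over
`O/𝔪` stays irreducible after any extension of scalars `f : O/𝔪 →+* k`.**  Let `τ` be the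
absolutely irreducible reduction; `GL_n(f) ∘ τ` is irreducible by definition, `σ` and `τ` are
residual representations along `id`, so `det(X - σ(g)) = det(X - τ(g))`
(`IsResidualRepOf.charpoly_eq`, Brauer–Nesbitt data) and hence
`det(X - GL_n(f)σ(g)) = det(X - GL_n(f)τ(g))`; irreducibility is detected by characteristic
polynomials (`isIrreducible_of_charpoly_eq`).  (`k` lives in the universe of `F`, as in
`IsAbsIrreducible`.) [cite: DarmonDiamondTaylor1995, §2.1, Prop. 2.6 (b)]
[cite: BourbakiAlgebreVIII2012, VIII § 20 n° 6, Thm. 2, Cor. 1] -/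
theorem IsResidualRepOf.isIrreducible_map_of_isResiduallyAbsIrreducible {ρ : G →* GL (Fin n) F}
    {σ : G →* GL (Fin n) (ResidueField O)} (hσ : IsResidualRepOf (RingHom.id _) ρ σ)
    (h : IsResiduallyAbsIrreducible O ρ) (f : ResidueField O →+* k) :
    (glRepresentation ((Matrix.GeneralLinearGroup.map f).comp σ)).IsIrreducible := by
  obtain ⟨τ, hτ, habs⟩ := h
  have hirrτ : (glRepresentation ((Matrix.GeneralLinearGroup.map f).comp τ)).IsIrreducible :=
    habs k f
  have hτ' : IsResidualRepOf (RingHom.id _) ρ τ :=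
    hτ.isResidualRepOf_of_isIrreducible habs.isIrreducible_glRepresentation
  refine Literature.RepresentationTheory.Semisimple.isIrreducible_of_charpoly_eq _ _ (fun g => ?_)
    hirrτ
  rw [MonoidHom.comp_apply, MonoidHom.comp_apply, charpoly_generalLinearGroup_map,
    charpoly_generalLinearGroup_map, hσ.charpoly_eq hτ' g]

/-- **For residually absolutely irreducible `ρ`, every residual representation `σ` over `O/𝔪`
pushes to a residual representation `GL_n(f) ∘ σ` along any `f : O/𝔪 →+* k`** (it is
irreducible there, `IsResidualRepOf.isIrreducible_map_of_isResiduallyAbsIrreducible`, hence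
semisimple, and `IsResidualRepOf.map` applies). [cite: ACCGHLNSTT2023, §1 (Notation)]
[cite: DarmonDiamondTaylor1995, §2.1, p. 54] -/
theorem IsResidualRepOf.map_of_isResiduallyAbsIrreducible {ρ : G →* GL (Fin n) F}
    {σ : G →* GL (Fin n) (ResidueField O)} (hσ : IsResidualRepOf (RingHom.id _) ρ σ)
    (h : IsResiduallyAbsIrreducible O ρ) (f : ResidueField O →+* k) :
    IsResidualRepOf f ρ ((Matrix.GeneralLinearGroup.map f).comp σ) := by
  have h1 := hσ.map_of_isIrreducible f (hσ.isIrreducible_map_of_isResiduallyAbsIrreducible h f)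
  rwa [RingHom.comp_id] at h1

end AbsIrreducible

/-! ### The `ℚ̄_ℓ` case: models of `ρ.residualRep` over discrete fields -/

section PadicAlgCl

variable {K : Type u} [Field K] {ℓ : ℕ} [Fact ℓ.Prime] {n : ℕ} {k : Type} [Field k]

namespace FramedGaloisRep

/-- **`GL_n(ι) ∘ ρ̄` is irreducible** for `ρ : Γ_K → GL_n(ℚ̄_ℓ)` residually absolutely irreducible,
`ρ̄ = ρ.residualRep` its chosen residual representation and any `ι : ℤ̄_ℓ/𝔪 →+* k`
(`residualRep_spec_of_isResiduallyAbsIrreducible`,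
`IsResidualRepOf.isIrreducible_map_of_isResiduallyAbsIrreducible`).
[cite: DarmonDiamondTaylor1995, §2.1, Prop. 2.6 (b)] -/
theorem isIrreducible_map_residualRep (ρ : FramedGaloisRep K (PadicAlgCl ℓ) n)
    (h : ρ.IsResiduallyAbsIrreducible) (ι : padicAlgClResidueField ℓ →+* k) :
    (glRepresentation ((Matrix.GeneralLinearGroup.map ι).comp ρ.residualRep)).IsIrreducible :=
  (ρ.residualRep_spec_of_isResiduallyAbsIrreducible h).1.isIrreducible_map_of_isResiduallyAbsIrreducible
    h ι

/-- **`GL_n(ι) ∘ ρ̄` is a residual representation of `ρ` along `ι`** (`ρ` residually absolutely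
irreducible). [cite: ACCGHLNSTT2023, §1 (Notation)] -/
theorem isResidualRepOf_map_residualRep (ρ : FramedGaloisRep K (PadicAlgCl ℓ) n)
    (h : ρ.IsResiduallyAbsIrreducible) (ι : padicAlgClResidueField ℓ →+* k) :
    ρ.IsResidualRepOf ι ((Matrix.GeneralLinearGroup.map ι).comp ρ.residualRep) :=
  (ρ.residualRep_spec_of_isResiduallyAbsIrreducible h).1.map_of_isResiduallyAbsIrreducible h ι

/-- **`GL_n(ι) ∘ ρ̄` has open kernel** (Deligne–Serre 6.12, `isOpen_ker_of_isResidualRepOf`).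
[cite: DeligneSerreASENS1974, 6.12] -/
theorem isOpen_ker_map_residualRep (ρ : FramedGaloisRep K (PadicAlgCl ℓ) n)
    (h : ρ.IsResiduallyAbsIrreducible) (ι : padicAlgClResidueField ℓ →+* k) :
    IsOpen ((((Matrix.GeneralLinearGroup.map ι).comp ρ.residualRep).ker :
      Subgroup (absoluteGaloisGroup K)) : Set (absoluteGaloisGroup K)) :=
  isOpen_ker_of_isResidualRepOf (ρ.isResidualRepOf_map_residualRep h ι)

/-- **The discrete continuous model of `ρ̄` over `k`.**  For `ρ : Γ_K → GL_n(ℚ̄_ℓ)` residually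
absolutely irreducible and a DISCRETE field `k` receiving `ℤ̄_ℓ/𝔪` along `ι`, the homomorphism
`GL_n(ι) ∘ ρ.residualRep` underlies a continuous `τ : FramedGaloisRep K k n` (its kernel is open,
`isOpen_ker_map_residualRep`, so it is locally constant), which is irreducible
(`isIrreducible_map_residualRep`) and a residual representation of `ρ` along `ι`
(`isResidualRepOf_map_residualRep`).  This is the object "`ρ̄ : G_K → GL_n(𝔽̄_ℓ)`" of the
literature (ACC+ §1), e.g. the `τ` over which `Tung2020_fontaineMazurGL2_two_tateTwist` and Serre's
conjecture `exists_newform_of_odd_irreducible` quantify. [cite: ACCGHLNSTT2023, §1 (Notation)]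
[cite: DeligneSerreASENS1974, 6.12] -/
theorem exists_framedGaloisRep_coe_eq_map_residualRep [TopologicalSpace k] [DiscreteTopology k]
    (ρ : FramedGaloisRep K (PadicAlgCl ℓ) n) (h : ρ.IsResiduallyAbsIrreducible)
    (ι : padicAlgClResidueField ℓ →+* k) :
    ∃ τ : FramedGaloisRep K k n,
      (τ : absoluteGaloisGroup K →* GL (Fin n) k) =
          (Matrix.GeneralLinearGroup.map ι).comp ρ.residualRep ∧
        τ.toGaloisRep.IsIrreducible ∧ ρ.IsResidualRepOf ι τ := by
  set σ : absoluteGaloisGroup K →* GL (Fin n) k :=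
    (Matrix.GeneralLinearGroup.map ι).comp ρ.residualRep with hσ
  have hker : IsOpen ((σ.ker : Subgroup (absoluteGaloisGroup K)) : Set (absoluteGaloisGroup K)) :=
    ρ.isOpen_ker_map_residualRep h ι
  -- a homomorphism with open kernel is continuous (it is locally constant)
  have hcont : Continuous σ := by
    refine continuous_of_continuousAt_one σ ?_
    rw [ContinuousAt, map_one]
    refine Filter.tendsto_def.mpr fun W hW => Filter.mem_of_superset (hker.mem_nhds σ.ker.one_mem) ?_
    intro x hx
    rw [Set.mem_preimage, (MonoidHom.mem_ker).mp hx]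
    exact mem_of_mem_nhds hW
  exact ⟨⟨σ, hcont⟩, rfl, ρ.isIrreducible_map_residualRep h ι, ρ.isResidualRepOf_map_residualRep h ι⟩

end FramedGaloisRep

end PadicAlgCl

/-! ### Characteristic `2`: every framed Galois representation is odd -/

section CharTwo

variable {K : Type u} [Field K] {k : Type w} [Field k] [TopologicalSpace k] {n : ℕ}

/-- **In characteristic `2` every `τ : Γ_K → GL_n(k)` is odd**: for a complex conjugation `c`,
`c² = 1` gives `det τ(c)² = 1`, so `det τ(c) = ±1`, and `1 = -1` in `k`.  (So the oddness
hypothesis of Serre's conjecture is vacuous at `p = 2`.) [folklore] -/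
theorem FramedGaloisRep.isOdd_of_charP_two [CharP k 2] (τ : FramedGaloisRep K k n) : τ.IsOdd := by
  intro φ c hc
  have hsq : ((Matrix.GeneralLinearGroup.det (τ c) : kˣ) : k) *
      ((Matrix.GeneralLinearGroup.det (τ c) : kˣ) : k) = 1 := by
    rw [← Units.val_mul, ← map_mul, ← map_mul, ← sq, hc.sq_eq_one, map_one, map_one, Units.val_one]
  rcases mul_self_eq_one_iff.mp hsq with h | h
  · exact Units.ext (by rw [h, Units.val_neg, Units.val_one, CharTwo.neg_eq])
  · exact Units.ext (by rw [h, Units.val_neg, Units.val_one])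

end CharTwo

end Literature.NumberTheory.GaloisRepresentations

end
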